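import Literature.AlgebraicGeometry.ModuliOfAbelianVarieties.SiegelModuliInterpretation
import Literature.AlgebraicGeometry.HodgeTheory.WeilDivisorPullbackAdjointEndomorphisms
import Literature.AlgebraicGeometry.Motives.BijectiveMorphismIsoGeneral
import Literature.Geometry.Kaehler.ComplexTorusIsogenies
import Literature.Geometry.Kaehler.ComplexTorusNeronSeveriEndomorphisms
import HarnessLib

/-!
# `D^Θ_{e′x} ∼ e^*D^Θ_x` on a complex abelian variety MARKED by a Siegel point, for endomorphisms whose integer torus lifts are
# adjoint for the integer Gram matrix of `c₁(Θ^an)` ([Lange 2023] §2.4.1 Prop. 2.4.2 (a), §1.4.2 Lemma 1.4.5; [Milne 2005] Thm. 6.11)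

Topic `AlgebraicGeometry/ModuliOfAbelianVarieties`, namespace `Literature.AlgebraicGeometry.ModuliOfAbelianVarieties`.  THEOREMS ONLY (no
definition, no named fact, no instance, no `sorry`).  Cell `hodgecm-mathlib` (D-0151), P6 «MOD programme», crux hLiu418 (`stmt-HodgeConjecture-24832`,
`--supports`, count-neutral), E-line `Cruxes/HLiu418/Lines/F0_P6a_PELWitnessE.lean`, organ **E6-R** step (R3a) (LEAD F0P6-plan (g2) 2026-09-01T22:33:07Z;
A-p04 (g23) CENSUS-E6R 28f566deafbc73d3): the junction between the E-line's marking currency (★ `SiegelAdelicMarking`: `m.Ψ`, `m.toFun`, integer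
torus lifts `mapMatrix m.Ψ m.Ψ M`, the `Mρ_rosati` matrix identity `M′ᵀ G = G M`) and ★ (R1) `HodgeTheory.weilDiv_map_linEquiv_pullback_weilDiv_of_form_adjoint`.
HC_CM is proved only modulo the 2 remaining named inputs (hLiu418 24832, h413 24833) until rung 0 closes; nothing here is about HC.

* §1 `ComplexTorus.form_adjoint_of_transpose_mul_intGram_eq` — `M′ᵀ G = G M` for the integer Gram matrix `G = intGram Φ E` of an NS form `E`
  and analytic representations `F, F′` of `M, M′` ⟹ `E(F′u, w) = E(u, F w)` ([Lange2023AbelianVarietiesComplex] §1.5.1 «`E(Φx, Φy) = ᵗx G y`»,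
  Prop. 2.4.2 (a)).
* §2 `SiegelAdelicMarking.weilDiv_map_linEquiv_pullback_weilDiv_of_transpose_mul_intGram_eq` — for a marked complex abelian variety (any `g`; the
  marking's chart is put on the model `ℂ^{dim A}` by `g = dim A`, ★ `SiegelAdelicMarking.dim_eq`) and endomorphisms `e, e′` with torus lifts `M, M′`
  through the marking, adjoint for `intGram m.Ψ p.form`: `D^Θ_{e′x} ∼ e^*D^Θ_x` for every complex point `x` (★ (R1)).
* §3 `SiegelAdelicMarking.isDominant_of_torusLift_det_ne_zero` — an endomorphism whose torus lift has non-zero determinant is DOMINANT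
  (surjective on the torus, [Lange2023AbelianVarietiesComplex] Lemma 1.1.11 ∕ ★ `mapMatrix_surjective_of_mulVec_surjective`; surjective on complex points
  ⟹ dominant, [GortzWedhorn2020] Prop. 3.35 ∕ ★ `Motives.isDominant_of_surjective_map`) — the `[IsDominant]` premiss of (R1)/(R2) for `ρ(b)`, `b ≠ 0`.

## References
* [Lange2023AbelianVarietiesComplex] H. Lange, *Abelian Varieties over the Complex Numbers* (2023), §1.1.2 Lemma 1.1.11 (p. 16), §1.5.1 (p. 47),
  §2.4.1 Prop. 2.4.2 (a) (p. 114), §1.4.2 Lemma 1.4.5 (p. 44).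
* [Milne2005ShimuraVarieties] J. S. Milne, *Introduction to Shimura varieties* (2005), §6 Thm. 6.11 p. 74 (marked abelian varieties).
* [GortzWedhorn2020] U. Görtz, T. Wedhorn, *Algebraic Geometry I*, Prop. 3.35.
-/

set_option autoImplicit false

noncomputable section

open Matrix CategoryTheory AlgebraicGeometry Function
open scoped Matrix

/-! ### §1 Matrix adjointness ⟹ form adjointness -/

namespace Literature.Geometry.Kaehler.ComplexTorus

/-- **`M′ᵀ G = G M` ⟹ `E(F′u, w) = E(u, F w)`**: if the integer matrices `M, M′` have `ℂ`-linear analytic representations `F, F′` for the period map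
`Φ : ℝ^ι ≃ V` (`Φ ∘ M_ℝ = F ∘ Φ`) and are ADJOINT for the integer Gram matrix `G = intGram Φ E` of the Néron–Severi form `E` of an Appell–Humbert datum
(`M′ᵀ G = G M`), then the analytic representations are adjoint for `E` — `E(Φx, Φy) = ᵗx G y` ([Lange2023AbelianVarietiesComplex] §1.5.1, ★
`dotProduct_latticeGram_mulVec`, ★ `map_intGram`). [cite: Lange2023AbelianVarietiesComplex, §1.5.1 (p. 47) and §2.4.1 Prop. 2.4.2 (a) (p. 114)] -/
theorem form_adjoint_of_transpose_mul_intGram_eq {ι : Type*} [Fintype ι] [DecidableEq ι] {V : Type*} [NormedAddCommGroup V] [NormedSpace ℂ V]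
    (Φ : (ι → ℝ) ≃L[ℝ] V) (p : AHData Φ) {M M' : Matrix ι ι ℤ} {F F' : V →L[ℂ] V}
    (hF : ∀ x, Φ ((M.map (Int.cast : ℤ → ℝ)) *ᵥ x) = F (Φ x)) (hF' : ∀ x, Φ ((M'.map (Int.cast : ℤ → ℝ)) *ᵥ x) = F' (Φ x))
    (hadj : M'ᵀ * intGram Φ p.form = intGram Φ p.form * M) (u w : V) :
    p.form ![F' u, w] = p.form ![u, F w] := by
  obtain ⟨x, rfl⟩ := Φ.surjective u
  obtain ⟨y, rfl⟩ := Φ.surjective w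
  -- the matrix identity over `ℝ`
  have h : (M'.map (Int.cast : ℤ → ℝ))ᵀ * latticeGram Φ p.form = latticeGram Φ p.form * M.map (Int.cast : ℤ → ℝ) := by
    have h0 := congrArg (Int.castRingHom ℝ).mapMatrix hadj
    rw [map_mul, map_mul] at h0
    have h1 : (Int.castRingHom ℝ).mapMatrix (intGram Φ p.form) = latticeGram Φ p.form := map_intGram Φ p.isNSForm_form
    rw [h1] at h0
    -- `f.mapMatrix Nᵀ = (N.map f)ᵀ` and `⇑(Int.castRingHom ℝ) = Int.cast`, definitionally
    exact h0
  rw [← hF', ← hF, ← dotProduct_latticeGram_mulVec, ← dotProduct_latticeGram_mulVec, Matrix.mulVec_mulVec, ← h,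
    Matrix.dotProduct_mulVec, Matrix.dotProduct_mulVec, ← Matrix.vecMul_transpose, Matrix.vecMul_vecMul]

end Literature.Geometry.Kaehler.ComplexTorus

namespace Literature.AlgebraicGeometry.ModuliOfAbelianVarieties

open Literature.AlgebraicGeometry.Motives (AbelianVariety AlgPoints CartierDivisor ComplexPoints)
open Literature.Geometry.Kaehler (ComplexTorus)
open Literature.Geometry.Kaehler.ComplexTorus (AHData intGram picClass mapMatrix)
open Literature.AlgebraicGeometry.HodgeTheory (cartierDivisorLineBundle)

variable {g : ℕ} {δ : Fin g → ℕ} {J : C0pm δ} {r : gspFinAdelic δ} {A : AbelianVariety ℂ}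

namespace SiegelAdelicMarking

/-! ### §2 The Rosati Weil-divisor identity under a marking -/

/-- **`D^Θ_{e′x} ∼ e^*D^Θ_x` ON A MARKED COMPLEX ABELIAN VARIETY** ([Lange2023AbelianVarietiesComplex] Prop. 2.4.2 (a) ∕ Lemma 1.4.5 through ★ (R1)):
`A` marked by `[J, r]` (★ `SiegelAdelicMarking`: analytification `m.toFun : ℂ^g ∕ m.Ψ(ℤ^{2g}) → A(ℂ)`), endomorphisms `e, e′` of `A` whose torus lifts
through the marking are the integer matrices `M, M′` (`e(m t̄) = m(M t̄)`, the reading of E6's σ1) with `ℂ`-linear analytic representations `F, F′`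
(`m.Ψ ∘ M_ℝ = F ∘ m.Ψ`), an Appell–Humbert datum `p` of `[𝒪(Θ)^an]` on the marking's chart, and the matrix adjointness `M′ᵀ G = G M` for
`G = intGram m.Ψ p.form` (E6's `Mρ_rosati` once `G = E_δ`, ★ `SiegelAdmissibleFrameGram`).  Then `D^Θ_{e′x} ∼ e^*D^Θ_x` for every `x ∈ A(ℂ)` (`e`
dominant).  The marking's chart lives on `ℂ^g` with `g = dim A` (★ `dim_eq`); substituting puts it on (R1)'s model.
[cite: Lange2023AbelianVarietiesComplex, §2.4.1 Prop. 2.4.2 (a) (p. 114), §1.4.2 Lemma 1.4.5 (p. 44)] [cite: Milne2005ShimuraVarieties, §6 Thm. 6.11 p. 74] -/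
theorem weilDiv_map_linEquiv_pullback_weilDiv_of_transpose_mul_intGram_eq (m : SiegelAdelicMarking J r A)
    (e e' : A ⟶ A) [IsDominant (AbelianVariety.Hom.toSchemeHom e)]
    {M M' : Matrix (Fin g ⊕ Fin g) (Fin g ⊕ Fin g) ℤ} {F F' : (Fin g → ℂ) →L[ℂ] (Fin g → ℂ)}
    (hF : ∀ x, m.Ψ ((M.map (Int.cast : ℤ → ℝ)) *ᵥ x) = F (m.Ψ x))
    (hF' : ∀ x, m.Ψ ((M'.map (Int.cast : ℤ → ℝ)) *ᵥ x) = F' (m.Ψ x))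
    (hM : ∀ t, AlgPoints.map e.hom.hom.hom (m.toFun t) = m.toFun (mapMatrix m.Ψ m.Ψ M t))
    (hM' : ∀ t, AlgPoints.map e'.hom.hom.hom (m.toFun t) = m.toFun (mapMatrix m.Ψ m.Ψ M' t))
    (Θ : CartierDivisor A.X.left) (p : AHData m.Ψ) (hp : AHData.toPic p = picClass (cartierDivisorLineBundle m.isAnalytification Θ))
    (hadj : M'ᵀ * intGram m.Ψ p.form = intGram m.Ψ p.form * M) (x : A.Points ℂ) :
    (A.weilDiv Θ (AlgPoints.map e'.hom.hom.hom x)).LinEquiv ((A.weilDiv Θ x).pullback (AbelianVariety.Hom.toSchemeHom e)) := by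
  classical
  -- put the marking's chart on the model `ℂ^{dim A}`
  obtain rfl : g = A.dim := m.dim_eq.symm
  exact HodgeTheory.weilDiv_map_linEquiv_pullback_weilDiv_of_form_adjoint m.isAnalytification m.toFun_add e e' hF hF'
    (fun t => (hM t).symm) (fun t => (hM' t).symm) Θ p hp
    (ComplexTorus.form_adjoint_of_transpose_mul_intGram_eq m.Ψ p hF hF' hadj) x

/-! ### §3 Dominance of an endomorphism from its torus lift -/

/-- **An endomorphism of a marked complex abelian variety whose integer torus lift has non-zero determinant is DOMINANT**: `mapMatrix M` is onto the
torus ([Lange2023AbelianVarietiesComplex] Lemma 1.1.11: `M_ℝ` is invertible; ★ `mapMatrix_surjective_of_mulVec_surjective`), the marking is a bijection onto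
`A(ℂ)`, so `e` is onto `A(ℂ)`, hence dominant ([GortzWedhorn2020] Prop. 3.35, ★ `Motives.isDominant_of_surjective_map`).
[cite: Lange2023AbelianVarietiesComplex, §1.1.2 Lemma 1.1.11 (p. 16)] [cite: GortzWedhorn2020, Prop. 3.35] -/
theorem isDominant_of_torusLift_det_ne_zero (m : SiegelAdelicMarking J r A) (e : A ⟶ A)
    {M : Matrix (Fin g ⊕ Fin g) (Fin g ⊕ Fin g) ℤ} (hM : ∀ t, AlgPoints.map e.hom.hom.hom (m.toFun t) = m.toFun (mapMatrix m.Ψ m.Ψ M t))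
    (hdet : M.det ≠ 0) : IsDominant (AbelianVariety.Hom.toSchemeHom e) := by
  -- `M_ℝ` is invertible, so `mapMatrix M` is onto the torus
  have hunit : IsUnit (M.map (Int.cast : ℤ → ℝ)) := by
    rw [Matrix.isUnit_iff_isUnit_det, show M.map (Int.cast : ℤ → ℝ) = (Int.castRingHom ℝ).mapMatrix M from rfl, ← RingHom.map_det,
      isUnit_iff_ne_zero]
    exact fun h => hdet (by exact_mod_cast (show ((M.det : ℤ) : ℝ) = 0 from h))
  have hsurj : Surjective (mapMatrix m.Ψ m.Ψ M) :=
    ComplexTorus.mapMatrix_surjective_of_mulVec_surjective m.Ψ m.Ψ ((Matrix.mulVec_surjective_iff_isUnit).2 hunit)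
  -- hence `e` is onto `A(ℂ)`
  have hpts : Surjective (AlgPoints.map (L := ℂ) e.hom.hom.hom) := by
    intro Q
    obtain ⟨t, rfl⟩ := m.bijective.2 Q
    obtain ⟨t', rfl⟩ := hsurj t
    exact ⟨m.toFun t', hM t'⟩
  haveI := A.isProper
  exact Motives.isDominant_of_surjective_map e.hom.hom.hom hpts

end SiegelAdelicMarking

end Literature.AlgebraicGeometry.ModuliOfAbelianVarieties

end
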